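import Summits.QuantumFields.YangMills.Theorems.UnitScaleTiltProp8FlatHBBound164
import Summits.QuantumFields.YangMills.Theorems.UnitScaleTiltProp8FlatCubeSequenceAdm
import Summits.QuantumFields.YangMills.Theorems.UnitScaleTiltProp8FlatCubeSequenceAlignedLevels
import Summits.QuantumFields.YangMills.Theorems.UnitScaleTiltProp8FlatPortChart
import Summits.QuantumFields.YangMills.Theorems.UnitScaleTiltProp8FlatOpsLettersAssembly
import HarnessLib

/-!
# Route `UnitScaleTilt`, crux K1 child «MinimiserStabilityRegPr» (stmt-QuantumFields-19200), registered stub V2′ `stub_halvingStep`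
# (skeleton v8 5b4e846794b80374) — **[Balaban1985Variational] (164) AT THE CUBE-SEQUENCE CARRIER FROM THE P2 TEXT, MODULO THE SIZES
# OF THE DATUM ONLY**: the geometry of (144) that makes the lower-level index bonds FAR from the cube `Δ(y₁)` (so that (155) enters
# with the factor `e^{−½δ₀R₁M₁}` of (163)), the weights `= 1` on the top cube (so that the rows are print's `|HB|, |∇^ηHB|, |∂^{η*}∂^ηHB|,
# |Δ^ηHB|`), and the junction `FlatHBBound164.rows164_quarter ⟸ FlatCubeOpsText.FlatOpsAdmAtMS` at `D := cubeSeqMT3 F n K x₀ ρ S M`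

Cell `ym3-torus` (HUMAN RULING D-0037, YM ladder rung R3 — continuum SU(2) YM₃ on the torus is a RUNG, not the Clay problem), width seat
`ym-ust-19200-w3` gen 2 (D-0149; H-map = w3 g0's `HALVING-SOCKET-w3g0-v2.md` §4 (d) «(160)/(155) data bounds at the carrier as
`hnear`/`hfar` of `rows164_quarter`»).  `--supports stmt-QuantumFields-19200 --as helper`; def-free, 0 sorry, standard axioms.

THE PRINT ([Balaban1985Variational] p. 300 (144)): *«□₀ ⊃ □₁ ⊃ … ⊃ □_k ⊃ □, dist(□_{n+1}, □_nᶜ) = R₁M₁Lⁿη»*; p. 302: *«K₁ = e^{iB} with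
|B| < 18d²L³Mε₀ (155) … for a plaquette p, or a bond b, we take a unit cube Δ₀ ⊂ Bʲ(Λ_j) containing p or b. The cube Δ₀ is contained in a big
cube of the size 2R₁M₁Lʲη»*; p. 303: *«|B(x,x′)| < (8d²L² + 4L²|x − y|)ε₁ for ⟨x,x′⟩ ∈ Π′_k^{(k−1)} ∪ Π″_k^{(k)} (160). This bound and the global
bound (152) imply the following bounds on the cube Δ(y₁) … |HB|, |∇^ηHB|, |∂^{η*}∂^ηHB|, |Δ^ηHB| ≦ B₀Σ_{c∈ℭ_k} e^{−δ₀d(y₁,c₋)}(L^{j(c)}η)⁻¹|B(c)| <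
… M_Δ max{ε₁, e^{−½δ₀R₁M₁}ε₀} (161)»*; p. 304: *«We may assume that R₁M₁ is sufficiently big, so that B₃e^{−½δ₀R₁M₁} ≦ ½. (163) Then we get
on Δ  |HB|, |∇^ηHB|, |∂^{η*}∂^ηHB|, |Δ^ηHB| < ¼M_Δ max{B₃ε₁, ½ε₀}. (164)»*.  The factor `e^{−½δ₀R₁M₁}` in front of the `ε₀`-datum is the
statement that EVERY lower-level index bond (`j(c) < k`, where only the global bound (155) is available) is at distance `≥ R₁M₁` from `Δ(y₁)`;
this is the geometry of (144) proved here for the tree's aligned cube sequence.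

WHAT THIS FILE PROVES (`D := cubeSeqM x₀ k hk ρ S M hM`, resp. `cubeSeqMT3 F n K x₀ ρ S M hM` at the d = 3 carrier, `k = K − n`):
* §1 `pow_mul_le_radM` (`Lⁱρ ≤ radM i`: the cubes grow at least geometrically), `distSite_iterBlockOf_le_pow` (`i` levels of blocking cost
  at most `Lⁱ` and `Lⁱ − 1`), **`distBI_ge_of_level_lt`** — THE FAR GEOMETRY OF (144): for every index bond `c` of level `j(c) < k` and every
  fine bond `b` whose `k`-block is within `r₀` of the centre block `c_k`, `distBI D b c ≥ ρ − r₀ − 1` (`ρ` = the radius of the top cube `□_k^{(k)}`;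
  print: `Δ(y₁)` of radius `M_Δ` inside `Π ⊂ □_k`, the lower territories `Λ_j`, `j < k`, outside `□_k`).
* §2 `distBI_nonneg`; `levWeight_eq_one_of_inOm_top` — on the top cube the P2 level weights are `(Lᵏη)^m = 1`; `inOm_top_of_dist` — a fine
  bond within `r₀ ≤ ρ` blocks of the centre lies in the top cube.
* §3 **`rows164_quarter_cubeSeqMT3`** — `FlatHBBound164.rows164_quarter` AT THE CUBE SEQUENCE with `near c :↔ j(c) = k`: given the P2 letters
  `HDecayLetterD`/`RowSum162` over a distance `dBI ≥ distBI`, (163), `R₁M₁ ≤ ρ − r₀ − 1`, the NEAR SIZE `|X(c)| ≤ C·M_Δ·ε₁·(distBI(b,c) + 1)` on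
  the top level ((160)) and the FAR SIZE `|X(c)| ≤ C·M_Δ·ε₀·L^{k−j(c)}` below it ((155)), the four rows at `b` are `≤ ¼M_Δ max{4CB₀B₃ε₁, ½ε₀}`;
  **`rows164_quarter_cubeSeqMT3_top`** — the same with the weights evaluated to `1` (print's (164) literally: `|HX(b)|`, `Lᵏ|∇HX(b)|`,
  `|∂*∂HX(b)|`, `L²ᵏ|ΔHX(b)|`).
* §4 **`quarter164_of_flatOpsAdmAtMS`** — THE BY-NAME JUNCTION WITH THE REGISTERED P2 TEXT: `FlatCubeOpsText.FlatOpsAdmAtMS L R₀ M₀ B₀ δ₀ B₃`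
  (whose body is a theorem at every admissible datum on tori with `≥ 5L` big blocks for odd `L ≥ 5`, `FlatPortBodyL0.body_of_adm22`, over
  lit-balaban's `B6Cor28EntriesKLevelV1L0.cor28_kLevel_H_DH`) delivers, at `D := cubeSeqMT3 F n K x₀ ρ S M` with `R·M ≤ S`
  (`FlatCubeSequenceAdm.adm22_cubeSeqMT3`), the canonical pinned `H`, `G̃` with their letters AND (164) for every datum of the stated near/far sizes.
So after this file the ¼-term of (167) at the carrier is a theorem MODULO: the P2 text (✓ for odd `L ≥ 5` on big tori), the near size (160)
(⇐ (7) + axial gauge + [Balaban1985RegularSpaces] Lemma 1; pillar P0/w3's next file) and the far size (155) (⇐ (152), pillar P1).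

HONEST SCOPE: geometry and bookkeeping; (160), (155), (152) and the chart identity (156) are NOT proved here.  No definition, no sorry, standard
axioms.  NOT a claim about the crux, the rung, or the mass gap.

References: T. Bałaban, CMP **102** (1985) 277–309 [Balaban1985Variational] (144) p.300, (155) p.302, (160)–(163) p.303, (164) p.304;
CMP **96** (1984) 223–250 [Balaban1984PropagatorsII] (2.1)–(2.4) p.224, Cor. 2.8 (2.150)–(2.151) p.249.
-/

set_option autoImplicit false

noncomputable section

open scoped BigOperators

namespace Summit.QuantumFields.YangMills.Theorems.HalvingQuarterCubeSeq

open Literature.MathematicalPhysics.QuantumFieldTheory.Balaban1983to89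
open B5Eq117TorusCarriers (Mk)
open B5Eq118OneStroke (iterBlockOf iterBlockOf_succ iterBlockOf_zero)
open B5Prop12FieldsLattice (distSite distSite_self distSite_nonneg)
open B5RowSumsP12Lattice (distSite_comm distSite_triangle)
open B6SectADomainsV1 (Domains)
open B6SectAOperatorsV1 (BondIdx dcE dcsE)
open B11Eq115Space (levOf)
open T3ContinuumYM3Torus (T3Family)
open FlatCubeOpsText (Adm22 distBI IsLevWeight IsFlatH IsFlatGt HSupLetterG GtSupLetterG GtLaplaceLetterG HDecayLetterD RowSum162
  FlatOpsAdmAtMS)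
open FlatCubeSequence (distSite_le_blockOf)
open FlatCubeSequenceAligned (radM radM_succ cubeFinM cubeSeqM cubeSeqMT3 mem_cubeFinM_of_dist cubeSeqM_Om_pos)
open FlatCubeSequenceAdm (adm22_cubeSeqMT3)
open FlatPortChart (mul_distSite_blockOf_le natCast_add_one_le_distSite)
open FlatOpsLettersAssembly (levWeight_nonneg)

/-! ## §1 The far geometry of (144) for the aligned cube sequence -/

section Geometry

variable {P : Params}

/-- **THE CUBES GROW AT LEAST GEOMETRICALLY**: `Lⁱ·ρ ≤ radM L M ρ S i` (`radM (i+1) = L·radM i + (L·M − 1) + S ≥ L·radM i`).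
[cite: Balaban1985Variational, (144) p.300] -/
theorem pow_mul_le_radM (L M ρ S : ℕ) : ∀ i : ℕ, L ^ i * ρ ≤ radM L M ρ S i
  | 0 => by simp [radM]
  | i + 1 => by
    rw [radM_succ, pow_succ]
    have ih := pow_mul_le_radM L M ρ S i
    calc L ^ i * L * ρ = L * (L ^ i * ρ) := by ring
      _ ≤ L * radM L M ρ S i := Nat.mul_le_mul_left _ ih
      _ ≤ L * radM L M ρ S i + (L * M - 1) + S := by omega

/-- **`i` LEVELS OF BLOCKING COST AT MOST A FACTOR `Lⁱ` AND `Lⁱ − 1`**: `dist_j(Bʲx, Bʲx′) ≤ Lⁱ·dist_{j+i}(B^{j+i}x, B^{j+i}x′) + (Lⁱ − 1)`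
(`j + i ≤ m + K`; `FlatCubeSequence.distSite_le_blockOf` iterated). [folklore] -/
theorem distSite_iterBlockOf_le_pow (x x' : Site P 0) (j : ℕ) : ∀ i : ℕ, j + i ≤ P.m + P.K →
    distSite (Mk P j) (iterBlockOf j x) (iterBlockOf j x') ≤
      (P.L : ℝ) ^ i * distSite (Mk P (j + i)) (iterBlockOf (j + i) x) (iterBlockOf (j + i) x') + ((P.L : ℝ) ^ i - 1)
  | 0, _ => by
    show distSite (Mk P j) (iterBlockOf j x) (iterBlockOf j x') ≤
      (P.L : ℝ) ^ 0 * distSite (Mk P j) (iterBlockOf j x) (iterBlockOf j x') + ((P.L : ℝ) ^ 0 - 1)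
    simp
  | i + 1, h => by
    have ih := distSite_iterBlockOf_le_pow x x' j i (by omega)
    have h1 : distSite (Mk P (j + i)) (iterBlockOf (j + i) x) (iterBlockOf (j + i) x') ≤
        (P.L : ℝ) * distSite (Mk P (j + (i + 1))) (iterBlockOf (j + (i + 1)) x) (iterBlockOf (j + (i + 1)) x') + ((P.L : ℝ) - 1) :=
      distSite_le_blockOf h (iterBlockOf (j + i) x) (iterBlockOf (j + i) x')
    have hL0 : (0 : ℝ) ≤ (P.L : ℝ) ^ i := by positivity
    have h2 := mul_le_mul_of_nonneg_left h1 hL0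
    rw [pow_succ]
    calc distSite (Mk P j) (iterBlockOf j x) (iterBlockOf j x')
        ≤ (P.L : ℝ) ^ i * distSite (Mk P (j + i)) (iterBlockOf (j + i) x) (iterBlockOf (j + i) x') + ((P.L : ℝ) ^ i - 1) := ih
      _ ≤ (P.L : ℝ) ^ i * ((P.L : ℝ) * distSite (Mk P (j + (i + 1))) (iterBlockOf (j + (i + 1)) x) (iterBlockOf (j + (i + 1)) x') +
            ((P.L : ℝ) - 1)) + ((P.L : ℝ) ^ i - 1) := by linarith
      _ = (P.L : ℝ) ^ i * (P.L : ℝ) * distSite (Mk P (j + (i + 1))) (iterBlockOf (j + (i + 1)) x) (iterBlockOf (j + (i + 1)) x') +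
            ((P.L : ℝ) ^ i * (P.L : ℝ) - 1) := by ring

/-- `distBI ≥ 0`. [cite: Balaban1985Variational, (161) p.303] -/
theorem distBI_nonneg (D : Domains P) (b : PBond P 0) (c : BondIdx D) : 0 ≤ distBI D b c := by
  unfold distBI
  exact mul_nonneg (pow_nonneg (inv_nonneg.2 (Nat.cast_nonneg _)) _) (distSite_nonneg _ _)

/-- **THE FAR GEOMETRY OF (144)** for the aligned cube sequence `D := cubeSeqM x₀ k hk ρ S M hM`: an index bond `c ∈ Λ_{j(c)}` of level `j(c) < k`
has its source OUTSIDE `□_{j(c)+1}` (it is not deep), while a fine bond `b` whose `k`-block is within `r₀` of the centre block `c_k` sits at the centre;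
since `□_{j+1}^{(j+1)}` has radius `radM (k−j−1) ≥ L^{k−j−1}ρ` in its own units, the (161)-distance `distBI D b c = L^{j(c)−k}·dist_{j(c)}(B^{j(c)}b₋, c₋)`
is at least `ρ − r₀ − 1`.  (Print: the territories `Λ_j`, `j < k`, lie outside `□_k ⊃ Π ⊃ Δ(y₁)`, so `d(y₁, c₋) ≥ R₁M₁` there — the source of the factor
`e^{−½δ₀R₁M₁}ε₀` in (161).) [cite: Balaban1985Variational, (144) p.300, (161) p.303] -/
theorem distBI_ge_of_level_lt (x₀ : Site P 0) {k : ℕ} (hk : k ≤ P.m + P.K) (ρ S M : ℕ) (hM : 1 ≤ M)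
    (c : BondIdx (cubeSeqM x₀ k hk ρ S M hM)) (hc : (c.1.1 : ℕ) < k) (b : PBond P 0) {r₀ : ℝ}
    (hb : distSite (Mk P k) (iterBlockOf k b.src) (iterBlockOf k x₀) ≤ r₀) :
    (ρ : ℝ) - r₀ - 1 ≤ distBI (cubeSeqM x₀ k hk ρ S M hM) b c := by
  -- the level `j` of `c` and the gap `k = j + (i + 1)`
  obtain ⟨i, hi⟩ : ∃ i : ℕ, k = (c.1.1 : ℕ) + (i + 1) := ⟨k - (c.1.1 : ℕ) - 1, by omega⟩
  have hjm : (c.1.1 : ℕ) + 1 ≤ P.m + P.K := by omega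
  have hL0 : (0 : ℝ) ≤ (P.L : ℝ) := Nat.cast_nonneg _
  have hLpos : (0 : ℝ) < (P.L : ℝ) := by exact_mod_cast P.L_pos
  -- (a) the source of `c` is not deep: its `(j+1)`-block lies outside `□_{j+1}^{(j+1)}`, a fortiori outside the ball of radius `radM (k − j − 1)`
  have hnd : ¬ (cubeSeqM x₀ k hk ρ S M hM).Deep (c.1.1 : ℕ) c.1.2.src := c.2.2.1
  have hOm : (cubeSeqM x₀ k hk ρ S M hM).Om ((c.1.1 : ℕ) + 1) = cubeFinM x₀ k ρ S M ((c.1.1 : ℕ) + 1) :=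
    cubeSeqM_Om_pos x₀ hk ρ S M hM (by omega) (by omega)
  have hout : (radM P.L M ρ S (k - ((c.1.1 : ℕ) + 1)) : ℝ) <
      distSite (Mk P ((c.1.1 : ℕ) + 1)) (blockOf c.1.2.src) (iterBlockOf ((c.1.1 : ℕ) + 1) x₀) := by
    by_contra hle
    rw [not_lt] at hle
    apply hnd
    show blockOf c.1.2.src ∈ (cubeSeqM x₀ k hk ρ S M hM).Om ((c.1.1 : ℕ) + 1)
    rw [hOm]
    exact mem_cubeFinM_of_dist x₀ k ρ S M ((c.1.1 : ℕ) + 1) hle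
  have hki : k - ((c.1.1 : ℕ) + 1) = i := by omega
  rw [hki] at hout
  have hout1 : (radM P.L M ρ S i : ℝ) + 1 ≤ distSite (Mk P ((c.1.1 : ℕ) + 1)) (blockOf c.1.2.src) (iterBlockOf ((c.1.1 : ℕ) + 1) x₀) :=
    natCast_add_one_le_distSite hout
  -- (b) one level down: `L·dist_{j+1}(B(c₋), c_{j+1}) ≤ dist_j(c₋, c_j) + (L − 1)`
  have hdown : (P.L : ℝ) * distSite (Mk P ((c.1.1 : ℕ) + 1)) (blockOf c.1.2.src) (iterBlockOf ((c.1.1 : ℕ) + 1) x₀) ≤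
      distSite (Mk P (c.1.1 : ℕ)) c.1.2.src (iterBlockOf (c.1.1 : ℕ) x₀) + ((P.L : ℝ) - 1) :=
    mul_distSite_blockOf_le hjm c.1.2.src (iterBlockOf (c.1.1 : ℕ) x₀)
  have hfarC : (P.L : ℝ) * (radM P.L M ρ S i : ℝ) + 1 ≤ distSite (Mk P (c.1.1 : ℕ)) c.1.2.src (iterBlockOf (c.1.1 : ℕ) x₀) := by
    have := mul_le_mul_of_nonneg_left hout1 hL0
    linarith
  -- (c) the fine bond's `j`-block is within `L^{i+1}·r₀ + (L^{i+1} − 1)` of `c_j`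
  have hup0 := distSite_iterBlockOf_le_pow b.src x₀ (c.1.1 : ℕ) (i + 1) (by omega)
  have hb' : distSite (Mk P ((c.1.1 : ℕ) + (i + 1))) (iterBlockOf ((c.1.1 : ℕ) + (i + 1)) b.src)
      (iterBlockOf ((c.1.1 : ℕ) + (i + 1)) x₀) ≤ r₀ := by
    rw [hi] at hb
    exact hb
  have hq0 : (0 : ℝ) ≤ (P.L : ℝ) ^ (i + 1) := by positivity
  have hup : distSite (Mk P (c.1.1 : ℕ)) (iterBlockOf (c.1.1 : ℕ) b.src) (iterBlockOf (c.1.1 : ℕ) x₀) ≤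
      (P.L : ℝ) ^ (i + 1) * r₀ + ((P.L : ℝ) ^ (i + 1) - 1) := by
    have := mul_le_mul_of_nonneg_left hb' hq0
    linarith
  -- (d) the cubes grow geometrically: `L^{i+1}ρ ≤ L·radM i`
  have hrad : (P.L : ℝ) ^ (i + 1) * (ρ : ℝ) ≤ (P.L : ℝ) * (radM P.L M ρ S i : ℝ) := by
    have h := pow_mul_le_radM P.L M ρ S i
    have hcast : ((P.L : ℝ) ^ i) * (ρ : ℝ) ≤ (radM P.L M ρ S i : ℝ) := by exact_mod_cast h
    have := mul_le_mul_of_nonneg_left hcast hL0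
    calc (P.L : ℝ) ^ (i + 1) * (ρ : ℝ) = (P.L : ℝ) * ((P.L : ℝ) ^ i * (ρ : ℝ)) := by ring
      _ ≤ (P.L : ℝ) * (radM P.L M ρ S i : ℝ) := this
  -- (e) triangle inequality
  have htri := distSite_triangle (Mk P (c.1.1 : ℕ)) c.1.2.src (iterBlockOf (c.1.1 : ℕ) b.src) (iterBlockOf (c.1.1 : ℕ) x₀)
  rw [distSite_comm (Mk P (c.1.1 : ℕ)) c.1.2.src (iterBlockOf (c.1.1 : ℕ) b.src)] at htri
  -- (f) the normalised distance
  have hDk : (cubeSeqM x₀ k hk ρ S M hM).k - (c.1.1 : ℕ) = i + 1 := by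
    show k - (c.1.1 : ℕ) = i + 1
    omega
  unfold distBI
  rw [hDk, inv_pow]
  rw [le_inv_mul_iff₀ (by positivity : (0 : ℝ) < (P.L : ℝ) ^ (i + 1))]
  have hq1 : (1 : ℝ) ≤ (P.L : ℝ) ^ (i + 1) := one_le_pow₀ (by exact_mod_cast P.L_pos)
  nlinarith

end Geometry

/-! ## §2 The top cube: weights `= 1`, membership from the distance to the centre -/

section TopCube

variable {F : T3Family} {n K : ℕ}

/-- **ON THE TOP CUBE THE P2 LEVEL WEIGHTS ARE `1`**: `w m b = (L^{j(b₋)}η)^m` with `j(b₋) = k = K − n` when the `k`-block of `b₋` lies in `Ω_k^{(k)}`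
(`η = L^{−(K−n)}`). [cite: Balaban1985Variational, p.286, (152) p.301] -/
theorem levWeight_eq_one_of_inOm_top {D : Domains (F.P K)} (hDk : D.k = K - n) {w : ℕ → PBond (F.P K) 0 → ℝ}
    (hw : IsLevWeight F n K D w) {b : PBond (F.P K) 0} (hb : D.InOm (K - n) b.src) (m : ℕ) : w m b = 1 := by
  rw [hw m b]
  have hlev : levOf (fun j => {x : Site (F.P K) 0 | D.InOm j x}) (K - n) b.src = K - n := by
    have h := (FlatCubeLevels.levOf_inOm_eq_top_iff D b.src).2 (by rw [hDk]; exact hb)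
    rw [hDk] at h
    exact h
  rw [hlev]
  have hL : (F.L : ℝ) ≠ 0 := Nat.cast_ne_zero.2 (by have := F.hL.2; omega)
  rw [inv_pow, mul_inv_cancel₀ (pow_ne_zero _ hL), one_pow]

/-- A fine bond whose `k`-block is within `r₀ ≤ ρ` of the centre block lies in the top cube `□_k` of `cubeSeqMT3 F n K x₀ ρ S M` (`1 ≤ k = K − n`).
[cite: Balaban1985Variational, (144) p.300, p.302 (Δ₀ ⊂ Π)] -/
theorem inOm_top_of_dist (hnK : n < K) (x₀ : Site (F.P K) 0) (ρ S M : ℕ) (hM : 1 ≤ M) {b : PBond (F.P K) 0} {r₀ : ℝ}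
    (hb : distSite (Mk (F.P K) (K - n)) (iterBlockOf (K - n) b.src) (iterBlockOf (K - n) x₀) ≤ r₀) (hr : r₀ ≤ (ρ : ℝ)) :
    (cubeSeqMT3 F n K x₀ ρ S M hM).InOm (K - n) b.src := by
  show iterBlockOf (K - n) b.src ∈ (cubeSeqM x₀ (K - n) (FlatMinimizerH.le_T3 F n K) ρ S M hM).Om (K - n)
  rw [cubeSeqM_Om_pos x₀ (FlatMinimizerH.le_T3 F n K) ρ S M hM (by omega) le_rfl]
  refine mem_cubeFinM_of_dist x₀ (K - n) ρ S M (K - n) ?_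
  rw [Nat.sub_self]
  show distSite (Mk (F.P K) (K - n)) (iterBlockOf (K - n) b.src) (iterBlockOf (K - n) x₀) ≤ (radM (F.P K).L M ρ S 0 : ℝ)
  simpa [radM] using hb.trans hr

end TopCube

/-! ## §3 (164) at the cube sequence, modulo the near/far sizes of the datum -/

section Junction

variable {F : T3Family} {n K : ℕ}

/-- **(164) AT THE CUBE-SEQUENCE CARRIER, MODULO THE SIZES OF THE DATUM** (`FlatHBBound164.rows164_quarter` with `near c :↔ j(c) = k`, the far
geometry `distBI_ge_of_level_lt`, and `dBI ≥ distBI`): for the P2 letters `HDecayLetterD`/`RowSum162` of `D := cubeSeqMT3 F n K x₀ ρ S M` over a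
dominating distance `dBI`, (163) `4CB₀B₃e^{−½δ₀R₁M₁} ≤ ½`, `R₁M₁ ≤ ρ − r₀ − 1`, a fine bond `b` whose `k`-block is within `r₀` of the centre block, and
a datum `X` of NEAR size `|X(c)| ≤ C·M_Δ·ε₁·(distBI(b,c) + 1)` on the top level ((160) after the triangle inequality) and FAR size
`|X(c)| ≤ C·M_Δ·ε₀·L^{k−j(c)}` below it ((155)), the four left-weighted rows at `b` are `≤ ¼M_Δ max{4CB₀B₃ε₁, ½ε₀}`.
[cite: Balaban1985Variational, (155) p.302, (160)-(163) p.303, (164) p.304] -/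
theorem rows164_quarter_cubeSeqMT3 (x₀ : Site (F.P K) 0) (ρ S M : ℕ) (hM : 1 ≤ M)
    {dBI : PBond (F.P K) 0 → BondIdx (cubeSeqMT3 F n K x₀ ρ S M hM) → ℝ} {w : ℕ → PBond (F.P K) 0 → ℝ}
    {H : (BondIdx (cubeSeqMT3 F n K x₀ ρ S M hM) → ℝ) →ₗ[ℝ] (PBond (F.P K) 0 → ℝ)} {δ₀ B₀ B₃ C MΔ ε₁ ε₀ R₁M₁ r₀ : ℝ}
    (hw : IsLevWeight F n K (cubeSeqMT3 F n K x₀ ρ S M hM) w)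
    (hdom : ∀ b c, distBI (cubeSeqMT3 F n K x₀ ρ S M hM) b c ≤ dBI b c)
    (hH : HDecayLetterD F n K (cubeSeqMT3 F n K x₀ ρ S M hM) dBI w H B₀ δ₀)
    (h162 : RowSum162 F n K (cubeSeqMT3 F n K x₀ ρ S M hM) dBI w δ₀ B₃)
    (hδ₀ : 0 ≤ δ₀) (hB₀ : 0 ≤ B₀) (hB₃ : 0 ≤ B₃) (hC : 0 ≤ C) (hMΔ : 0 ≤ MΔ) (hε₁ : 0 ≤ ε₁) (hε₀ : 0 ≤ ε₀)
    (h163 : 4 * C * B₀ * B₃ * Real.exp (-(δ₀ / 2 * R₁M₁)) ≤ 1 / 2) (hρ : R₁M₁ ≤ (ρ : ℝ) - r₀ - 1)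
    {X : BondIdx (cubeSeqMT3 F n K x₀ ρ S M hM) → ℝ} {b : PBond (F.P K) 0}
    (hb : distSite (Mk (F.P K) (K - n)) (iterBlockOf (K - n) b.src) (iterBlockOf (K - n) x₀) ≤ r₀)
    (hnear : ∀ c : BondIdx (cubeSeqMT3 F n K x₀ ρ S M hM), (c.1.1 : ℕ) = K - n →
      |X c| ≤ C * MΔ * ε₁ * (distBI (cubeSeqMT3 F n K x₀ ρ S M hM) b c + 1))
    (hfar : ∀ c : BondIdx (cubeSeqMT3 F n K x₀ ρ S M hM), (c.1.1 : ℕ) < K - n →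
      |X c| ≤ C * MΔ * ε₀ * (F.L : ℝ) ^ ((K - n) - (c.1.1 : ℕ))) :
    w 1 b * (w 1 b * |H X b|) ≤ 1 / 4 * MΔ * max (4 * C * B₀ * B₃ * ε₁) (ε₀ / 2) ∧
    (∀ ν : Fin 3, w 1 b * (w 2 b * (F.L : ℝ) ^ (K - n) * |H X ⟨b.src.shift ν, b.dir⟩ - H X b|) ≤
      1 / 4 * MΔ * max (4 * C * B₀ * B₃ * ε₁) (ε₀ / 2)) ∧
    w 1 b * (w 3 b * |(dcsE ((F.L : ℝ) ^ (K - n)) (dcE ((F.L : ℝ) ^ (K - n)) (WithLp.toLp 2 (H X)))) b|) ≤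
      1 / 4 * MΔ * max (4 * C * B₀ * B₃ * ε₁) (ε₀ / 2) ∧
    w 1 b * (w 3 b * ((F.L : ℝ) ^ (K - n)) ^ 2 *
        |∑ ν : Fin 3, ((H X b - H X ⟨b.src.shift ν, b.dir⟩) + (H X b - H X ⟨b.src.unshift ν, b.dir⟩))|) ≤
      1 / 4 * MΔ * max (4 * C * B₀ * B₃ * ε₁) (ε₀ / 2) := by
  have hCMε₁ : 0 ≤ C * MΔ * ε₁ := by positivity
  refine FlatHBBound164.rows164_quarter hH h162 hδ₀ hB₀ hB₃ hC hMΔ hε₁ hε₀ h163 (fun c => (c.1.1 : ℕ) = K - n)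
    (levWeight_nonneg hw 1 b) (fun c => (distBI_nonneg _ b c).trans (hdom b c)) (fun c hc => ?_) (fun c hc => ?_)
  · -- near: top level, `L^{k − j(c)} = 1`, `distBI ≤ dBI`
    have hpow : (F.L : ℝ) ^ ((K - n) - (c.1.1 : ℕ)) = 1 := by rw [hc, Nat.sub_self, pow_zero]
    rw [hpow, mul_one]
    calc |X c| ≤ C * MΔ * ε₁ * (distBI (cubeSeqMT3 F n K x₀ ρ S M hM) b c + 1) := hnear c hc
      _ ≤ C * MΔ * ε₁ * (dBI b c + 1) := mul_le_mul_of_nonneg_left (by linarith [hdom b c]) hCMε₁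
  · -- far: lower level, at distance `≥ ρ − r₀ − 1 ≥ R₁M₁`
    have hlt : (c.1.1 : ℕ) < K - n := by
      have h1 : (c.1.1 : ℕ) < (cubeSeqMT3 F n K x₀ ρ S M hM).k + 1 := c.1.1.isLt
      have h2 : (cubeSeqMT3 F n K x₀ ρ S M hM).k = K - n := rfl
      omega
    refine ⟨hfar c hlt, hρ.trans ((distBI_ge_of_level_lt x₀ (FlatMinimizerH.le_T3 F n K) ρ S M hM c hlt b hb).trans (hdom b c))⟩

/-- **(164) LITERALLY, ON THE TOP CUBE** (weights `= 1`; `1 ≤ k`, `r₀ ≤ ρ`): under the hypotheses of `rows164_quarter_cubeSeqMT3`,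
`|HX(b)|, Lᵏ|∇HX(b)|, |∂^{η*}∂^ηHX(b)|, L²ᵏ|ΔHX(b)| ≤ ¼M_Δ max{4CB₀B₃ε₁, ½ε₀}` — print's four quantities in the normalisation `η = L^{−k}`.
[cite: Balaban1985Variational, (164) p.304] -/
theorem rows164_quarter_cubeSeqMT3_top (hnK : n < K) (x₀ : Site (F.P K) 0) (ρ S M : ℕ) (hM : 1 ≤ M)
    {dBI : PBond (F.P K) 0 → BondIdx (cubeSeqMT3 F n K x₀ ρ S M hM) → ℝ} {w : ℕ → PBond (F.P K) 0 → ℝ}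
    {H : (BondIdx (cubeSeqMT3 F n K x₀ ρ S M hM) → ℝ) →ₗ[ℝ] (PBond (F.P K) 0 → ℝ)} {δ₀ B₀ B₃ C MΔ ε₁ ε₀ R₁M₁ r₀ : ℝ}
    (hw : IsLevWeight F n K (cubeSeqMT3 F n K x₀ ρ S M hM) w)
    (hdom : ∀ b c, distBI (cubeSeqMT3 F n K x₀ ρ S M hM) b c ≤ dBI b c)
    (hH : HDecayLetterD F n K (cubeSeqMT3 F n K x₀ ρ S M hM) dBI w H B₀ δ₀)
    (h162 : RowSum162 F n K (cubeSeqMT3 F n K x₀ ρ S M hM) dBI w δ₀ B₃)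
    (hδ₀ : 0 ≤ δ₀) (hB₀ : 0 ≤ B₀) (hB₃ : 0 ≤ B₃) (hC : 0 ≤ C) (hMΔ : 0 ≤ MΔ) (hε₁ : 0 ≤ ε₁) (hε₀ : 0 ≤ ε₀) (hR : 0 ≤ R₁M₁)
    (h163 : 4 * C * B₀ * B₃ * Real.exp (-(δ₀ / 2 * R₁M₁)) ≤ 1 / 2) (hρ : R₁M₁ ≤ (ρ : ℝ) - r₀ - 1)
    {X : BondIdx (cubeSeqMT3 F n K x₀ ρ S M hM) → ℝ} {b : PBond (F.P K) 0}
    (hb : distSite (Mk (F.P K) (K - n)) (iterBlockOf (K - n) b.src) (iterBlockOf (K - n) x₀) ≤ r₀)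
    (hnear : ∀ c : BondIdx (cubeSeqMT3 F n K x₀ ρ S M hM), (c.1.1 : ℕ) = K - n →
      |X c| ≤ C * MΔ * ε₁ * (distBI (cubeSeqMT3 F n K x₀ ρ S M hM) b c + 1))
    (hfar : ∀ c : BondIdx (cubeSeqMT3 F n K x₀ ρ S M hM), (c.1.1 : ℕ) < K - n →
      |X c| ≤ C * MΔ * ε₀ * (F.L : ℝ) ^ ((K - n) - (c.1.1 : ℕ))) :
    |H X b| ≤ 1 / 4 * MΔ * max (4 * C * B₀ * B₃ * ε₁) (ε₀ / 2) ∧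
    (∀ ν : Fin 3, (F.L : ℝ) ^ (K - n) * |H X ⟨b.src.shift ν, b.dir⟩ - H X b| ≤ 1 / 4 * MΔ * max (4 * C * B₀ * B₃ * ε₁) (ε₀ / 2)) ∧
    |(dcsE ((F.L : ℝ) ^ (K - n)) (dcE ((F.L : ℝ) ^ (K - n)) (WithLp.toLp 2 (H X)))) b| ≤ 1 / 4 * MΔ * max (4 * C * B₀ * B₃ * ε₁) (ε₀ / 2) ∧
    ((F.L : ℝ) ^ (K - n)) ^ 2 * |∑ ν : Fin 3, ((H X b - H X ⟨b.src.shift ν, b.dir⟩) + (H X b - H X ⟨b.src.unshift ν, b.dir⟩))| ≤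
      1 / 4 * MΔ * max (4 * C * B₀ * B₃ * ε₁) (ε₀ / 2) := by
  have hr : r₀ ≤ (ρ : ℝ) := by linarith
  have hin := inOm_top_of_dist hnK x₀ ρ S M hM hb hr
  have h1 := levWeight_eq_one_of_inOm_top (D := cubeSeqMT3 F n K x₀ ρ S M hM) rfl hw hin
  obtain ⟨r1, r2, r3, r4⟩ := rows164_quarter_cubeSeqMT3 x₀ ρ S M hM hw hdom hH h162 hδ₀ hB₀ hB₃ hC hMΔ hε₁ hε₀ h163 hρ hb hnear hfar
  rw [h1 1] at r1 r2 r3 r4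
  rw [h1 2] at r2
  rw [h1 3] at r3 r4
  refine ⟨by simpa using r1, fun ν => by simpa using r2 ν, by simpa using r3, by simpa using r4⟩

end Junction

/-! ## §4 The by-name junction with the registered P2 text `FlatOpsAdmAtMS` -/

section P2

variable {L R₀ M₀ : ℕ} {B₀ δ₀ B₃ : ℝ}

/-- **THE ¼-TERM OF (167) FROM THE REGISTERED P2 TEXT, MODULO THE SIZES OF THE DATUM**: `FlatCubeOpsText.FlatOpsAdmAtMS L R₀ M₀ B₀ δ₀ B₃`
(P2; its body is `FlatPortBodyL0.body_of_adm22` at every admissible datum for odd `L ≥ 5` on tori with `≥ 5L` big blocks, over lit-balaban's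
`B6Cor28EntriesKLevelV1L0.cor28_kLevel_H_DH`) delivers at the cube sequence `D := cubeSeqMT3 F n K x₀ ρ S M` (`M = Lᵃ ≥ M₀`, `R ≥ R₀`, `R·M ≤ S`:
`Adm22` by `FlatCubeSequenceAdm.adm22_cubeSeqMT3`) the CANONICAL `H`, `G̃` (pinned by `IsFlatH`/`IsFlatGt`) with their guarded letters, and, for
every bond `b` within `r₀` blocks of the centre, (163) `4CB₀B₃e^{−½δ₀R₁M₁} ≤ ½` and `R₁M₁ ≤ ρ − r₀ − 1`, every datum `X` with the near size
((160)-shape) on the top level and the far size ((155)-shape) below: (164) `|HX|, Lᵏ|∇HX|, |∂*∂HX|, L²ᵏ|ΔHX| ≤ ¼M_Δ max{4CB₀B₃ε₁, ½ε₀}` at `b`.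
[cite: Balaban1985Variational, (155) p.302, (160)-(163) p.303, (164) p.304; Balaban1984PropagatorsII, (2.1)-(2.2) p.224, Cor. 2.8 (2.150)-(2.151) p.249] -/
theorem quarter164_of_flatOpsAdmAtMS (hP2 : FlatOpsAdmAtMS L R₀ M₀ B₀ δ₀ B₃) (hB₀ : 0 ≤ B₀) (hδ₀ : 0 ≤ δ₀) (hB₃ : 0 ≤ B₃)
    (F : T3Family) (hF : F.L = L) (n K : ℕ) (hnK : n < K) (R M : ℕ) (hR : R₀ ≤ R) (hM₀ : M₀ ≤ M) (hpow : ∃ a : ℕ, M = L ^ a)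
    (hM : 1 ≤ M) (x₀ : Site (F.P K) 0) (ρ S : ℕ) (hRS : R * M ≤ S)
    (w : ℕ → PBond (F.P K) 0 → ℝ) (hw : IsLevWeight F n K (cubeSeqMT3 F n K x₀ ρ S M hM) w) :
    ∃ (H : (BondIdx (cubeSeqMT3 F n K x₀ ρ S M hM) → ℝ) →ₗ[ℝ] (PBond (F.P K) 0 → ℝ))
      (Gt : (PBond (F.P K) 0 → ℝ) →ₗ[ℝ] (PBond (F.P K) 0 → ℝ)),
      IsFlatH F n K (cubeSeqMT3 F n K x₀ ρ S M hM) H ∧ IsFlatGt F n K (cubeSeqMT3 F n K x₀ ρ S M hM) Gt ∧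
      HSupLetterG F n K (cubeSeqMT3 F n K x₀ ρ S M hM) w H B₀ ∧ GtSupLetterG F n K w Gt B₀ ∧ GtLaplaceLetterG F n K w Gt B₀ ∧
      ∀ (C MΔ ε₁ ε₀ R₁M₁ r₀ : ℝ), 0 ≤ C → 0 ≤ MΔ → 0 ≤ ε₁ → 0 ≤ ε₀ → 0 ≤ R₁M₁ →
        4 * C * B₀ * B₃ * Real.exp (-(δ₀ / 2 * R₁M₁)) ≤ 1 / 2 → R₁M₁ ≤ (ρ : ℝ) - r₀ - 1 →
        ∀ (X : BondIdx (cubeSeqMT3 F n K x₀ ρ S M hM) → ℝ) (b : PBond (F.P K) 0),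
          distSite (Mk (F.P K) (K - n)) (iterBlockOf (K - n) b.src) (iterBlockOf (K - n) x₀) ≤ r₀ →
          (∀ c : BondIdx (cubeSeqMT3 F n K x₀ ρ S M hM), (c.1.1 : ℕ) = K - n →
            |X c| ≤ C * MΔ * ε₁ * (distBI (cubeSeqMT3 F n K x₀ ρ S M hM) b c + 1)) →
          (∀ c : BondIdx (cubeSeqMT3 F n K x₀ ρ S M hM), (c.1.1 : ℕ) < K - n →
            |X c| ≤ C * MΔ * ε₀ * (F.L : ℝ) ^ ((K - n) - (c.1.1 : ℕ))) →
          |H X b| ≤ 1 / 4 * MΔ * max (4 * C * B₀ * B₃ * ε₁) (ε₀ / 2) ∧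
          (∀ ν : Fin 3, (F.L : ℝ) ^ (K - n) * |H X ⟨b.src.shift ν, b.dir⟩ - H X b| ≤ 1 / 4 * MΔ * max (4 * C * B₀ * B₃ * ε₁) (ε₀ / 2)) ∧
          |(dcsE ((F.L : ℝ) ^ (K - n)) (dcE ((F.L : ℝ) ^ (K - n)) (WithLp.toLp 2 (H X)))) b| ≤
            1 / 4 * MΔ * max (4 * C * B₀ * B₃ * ε₁) (ε₀ / 2) ∧
          ((F.L : ℝ) ^ (K - n)) ^ 2 * |∑ ν : Fin 3, ((H X b - H X ⟨b.src.shift ν, b.dir⟩) + (H X b - H X ⟨b.src.unshift ν, b.dir⟩))| ≤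
            1 / 4 * MΔ * max (4 * C * B₀ * B₃ * ε₁) (ε₀ / 2) := by
  have hAdm : Adm22 (cubeSeqMT3 F n K x₀ ρ S M hM) R M := adm22_cubeSeqMT3 F n K x₀ ρ hM hRS
  obtain ⟨H, Gt, hFH, hFG, hHs, hGs, hGl, dBI, hdom, h162, hHd⟩ :=
    hP2 F hF n K hnK R M hR hM₀ hpow (cubeSeqMT3 F n K x₀ ρ S M hM) rfl hAdm w hw
  refine ⟨H, Gt, hFH, hFG, hHs, hGs, hGl, ?_⟩
  intro C MΔ ε₁ ε₀ R₁M₁ r₀ hC hMΔ hε₁ hε₀ hR1 h163 hρ X b hb hnear hfar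
  exact rows164_quarter_cubeSeqMT3_top hnK x₀ ρ S M hM hw hdom hHd h162 hδ₀ hB₀ hB₃ hC hMΔ hε₁ hε₀ hR1 h163 hρ hb hnear hfar

end P2

end Summit.QuantumFields.YangMills.Theorems.HalvingQuarterCubeSeq

end
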